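import Summits.CriticalPhenomena.CardyFormulaZ2.Theorems.CardyComplexConeSLESixFamiliesGiveCardySmoothMarkFamiliesPart7
import Literature.Probability.LatticeModels.MeshDomainJordan
import HarnessLib

/-!
# Smooth-mark discretisation families, part 8: per-mark ingredients of the labelling

Helper file for stub `stub_smoothMarkFamilies` of line `collar-touch-sandwich` of crux
`SLESixFamiliesGiveCardy` (stmt-CriticalPhenomena-9654).  At a smooth mark `D.pt i` with normalised
frame data (parts 2–7) and a small mesh `δ` (`128 δ ≤ R`), writing `C x` for the COLUMN TEST
`⌊α/δ⌋ + 1 ≤ col x ↔ σ = 0` ("the site `x` is labelled by the arc `D.arc 0`"):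

* `eventually_bulk`: the bulk input of parts 2–3 holds for all small meshes (Jordan bulk lemma);
* `label_iff_column`: any labelling which is the column test within `6δ` of the mark and the
  Voronoi comparison `infDist arc 0 ≤ infDist arc 1` beyond agrees with the column test on all
  boundary sites within `R/4 - 2δ` of the mark;
* `column_iff_of_shared_nearest`: two such boundary sites with a common nearest frontier point have
  the same column test;
* `cut_edge_facts`, `eq_cut_of_crossing`: the cut edge of part 3 joins two boundary sites with
  opposite column tests, is within `5δ` of the mark, borders exactly one inner face, and is the only
  edge of `Ω_δ` near the mark between boundary sites with opposite column tests.
-/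

noncomputable section

open Set Metric
open Literature.Probability Literature.Probability.RandomPlanarGeometry
  Literature.Probability.LatticeModels Literature.Probability.Percolation

namespace Summit.CriticalPhenomena.CardyFormulaZ2.Cruxes.SLESixFamiliesGiveCardy.CollarTouchSandwich

namespace SmoothMark

section PerMark

variable (D : DobrushinDomain) (i : Fin 2) {k : Fin 2} {s t : ℤ} {U V : ℂ} {G : ℝ → ℝ} {α R : ℝ}
  {σ : Fin 2} {δ : ℝ} {N : ℤ → ℤ}
  (hs : s = 1 ∨ s = -1) (ht : t = 1 ∨ t = -1)
  (hU : U = Site.toComplex (Pi.single k s)) (hV : V = Site.toComplex (Pi.single k.rev t))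
  (hp : D.pt i = (α : ℂ) * U + ((G α : ℝ) : ℂ) * V)
  (hmono : Monotone G) (hlip : ∀ a b, |G a - G b| ≤ |a - b|)
  (hepi : ∀ a b : ℝ, dist ((a : ℂ) * U + (b : ℂ) * V) (D.pt i) < R →
    ((a : ℂ) * U + (b : ℂ) * V ∈ D.carrier ↔ G a < b))
  (hdiff : ∀ c, |c - α| < R → DifferentiableAt ℝ G c)
  (hσp : ∀ c, α < c → dist ((c : ℂ) * U + ((G c : ℝ) : ℂ) * V) (D.pt i) < R →
    (c : ℂ) * U + ((G c : ℝ) : ℂ) * V ∈ D.arc σ ∧ (c : ℂ) * U + ((G c : ℝ) : ℂ) * V ∉ D.arc (σ + 1))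
  (hσm : ∀ c, c < α → dist ((c : ℂ) * U + ((G c : ℝ) : ℂ) * V) (D.pt i) < R →
    (c : ℂ) * U + ((G c : ℝ) : ℂ) * V ∈ D.arc (σ + 1) ∧ (c : ℂ) * U + ((G c : ℝ) : ℂ) * V ∉ D.arc σ)
  (hfar : R ≤ dist (D.pt (i + 1)) (D.pt i))
  (hδ : 0 < δ) (hδR : 128 * δ ≤ R) (hN : ∀ j : ℤ, N j = ⌊G (δ * j) / δ⌋ + 1)
  (hbulk : ∀ x : Site 2, |δ * (s * x k) - α| ≤ R / 4 → 3 * R / 8 ≤ δ * (t * x k.rev) - G α →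
    δ * (t * x k.rev) - G α ≤ R / 2 → x ∈ meshDomain D.carrier δ)

include hs ht hU hV hp hlip hepi in
/-- **Bulk input for all small meshes.** The sites of the band above the mark belong to the
discrete domain `meshDomain D.carrier δ` for all small `δ` (the band is a compact subset of the
domain; Jordan bulk lemma `JordanDomain.exists_forall_mem_meshDomain_and_reachable`). [folklore] -/
theorem eventually_bulk (hR : 0 < R) : ∃ δ₀ > 0, ∀ δ : ℝ, 0 < δ → δ < δ₀ → ∀ x : Site 2,
    |δ * (s * x k) - α| ≤ R / 4 → 3 * R / 8 ≤ δ * (t * x k.rev) - G α →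
    δ * (t * x k.rev) - G α ≤ R / 2 → x ∈ meshDomain D.carrier δ := by
  obtain ⟨hK, hKΩ⟩ := band_subset_carrier D i hs ht hU hV hp hR hlip hepi
  obtain ⟨δ₀, hδ₀, h⟩ := D.exists_forall_mem_meshDomain_and_reachable hK hKΩ
  refine ⟨δ₀, hδ₀, fun δ hδ hδδ₀ x h1 h2 h3 => (h δ hδ hδδ₀).1 x ?_⟩
  refine ⟨(δ * (s * x k), δ * (t * x k.rev)), ⟨⟨?_, ?_⟩, ?_, ?_⟩, (meshPoint_eq_frame hs ht hU hV δ x).symm⟩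
  · linarith [(abs_le.1 h1).1]
  · linarith [(abs_le.1 h1).2]
  · dsimp only; linarith
  · dsimp only; linarith

include hs ht hU hV hp hmono hlip hepi hσp hσm hfar hδ hδR hN hbulk in
/-- **A mixed labelling agrees with the column test near the mark.** [folklore] -/
theorem label_iff_column (P : Site 2 → Prop)
    (hnear : ∀ x, dist (meshPoint δ x) (D.pt i) < 6 * δ → (P x ↔ (⌊α / δ⌋ + 1 ≤ s * x k ↔ σ = 0)))
    (hvor : ∀ x, 6 * δ ≤ dist (meshPoint δ x) (D.pt i) → 6 * δ ≤ dist (meshPoint δ x) (D.pt (i + 1)) →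
      (P x ↔ infDist (meshPoint δ x) (D.arc 0) ≤ infDist (meshPoint δ x) (D.arc 1)))
    {x : Site 2} (hx : x ∈ (⟨D.carrier, δ, ∅, ∅⟩ : DiscreteDobrushin).zdBoundary)
    (hxp : dist (meshPoint δ x) (D.pt i) < R / 4 - 2 * δ) :
    P x ↔ (⌊α / δ⌋ + 1 ≤ s * x k ↔ σ = 0) := by
  by_cases hn : dist (meshPoint δ x) (D.pt i) < 6 * δ
  · exact hnear x hn
  · push Not at hn
    have hother : 6 * δ ≤ dist (meshPoint δ x) (D.pt (i + 1)) := by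
      have := dist_triangle (D.pt (i + 1)) (meshPoint δ x) (D.pt i)
      rw [dist_comm (D.pt (i + 1)) (meshPoint δ x)] at this
      linarith
    rw [hvor x hn hother]
    exact voronoi_iff_column D i hs ht hU hV hp hmono hlip hepi hσp hσm hδ (by linarith) hN hbulk hx hxp hn

include hs ht hU hV hp hmono hlip hepi hdiff hδ hδR hN hbulk in
/-- **Shared nearest frontier point ⇒ same column test.** [folklore] -/
theorem column_iff_of_shared_nearest {x y : Site 2}
    (hx : x ∈ (⟨D.carrier, δ, ∅, ∅⟩ : DiscreteDobrushin).zdBoundary)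
    (hy : y ∈ (⟨D.carrier, δ, ∅, ∅⟩ : DiscreteDobrushin).zdBoundary)
    (hxp : dist (meshPoint δ x) (D.pt i) < R / 4 - 2 * δ) (hyp : dist (meshPoint δ y) (D.pt i) < R / 4 - 2 * δ)
    {q : ℂ} (hq : q ∈ frontier D.carrier)
    (hqx : dist (meshPoint δ x) q = infDist (meshPoint δ x) (frontier D.carrier))
    (hqy : dist (meshPoint δ y) q = infDist (meshPoint δ y) (frontier D.carrier)) :
    (⌊α / δ⌋ + 1 ≤ s * x k ↔ σ = 0) ↔ (⌊α / δ⌋ + 1 ≤ s * y k ↔ σ = 0) := by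
  have hδR' : 64 * δ ≤ R := by linarith
  have : s * x k = s * y k := by
    rcases lt_trichotomy (s * x k) (s * y k) with h | h | h
    · exact absurd (not_shared_nearest D i hs ht hU hV hp hmono hlip hepi hdiff hδ hδR' hN hbulk hx hy hxp hyp
        hq hqx hqy h) id
    · exact h
    · exact absurd (not_shared_nearest D i hs ht hU hV hp hmono hlip hepi hdiff hδ hδR' hN hbulk hy hx hyp hxp
        hq hqy hqx h) id
  rw [this]

/-! ### The cut edge at the mark -/

variable (j₀ : ℤ) (hj₀ : j₀ = ⌊α / δ⌋ + 1)

include hδ hj₀ in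
/-- The cut column is next to the mark: `|δ j₀ - α| ≤ δ`. [folklore] -/
theorem abs_cut_col_le : |δ * j₀ - α| ≤ δ := by
  rw [hj₀]
  have h1 := Int.floor_le (α / δ)
  have h2 := Int.lt_floor_add_one (α / δ)
  push_cast
  rw [abs_le]
  constructor
  · have : δ * (α / δ) = α := mul_div_cancel₀ _ hδ.ne'
    nlinarith
  · have : δ * (α / δ) = α := mul_div_cancel₀ _ hδ.ne'
    nlinarith

include hs ht hU hV hp hmono hlip hepi hδ hδR hN hbulk hj₀ in
/-- **The cut edge.** Its endpoints `z₀ = (j₀ - 1, N j₀)`, `z₁ = (j₀, N j₀)` (frame coordinates) are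
boundary sites within `5δ` of the mark, joined in `Ω_δ`, of frame columns `j₀ - 1` and `j₀`, and the
edge is a side of exactly one inner face. [folklore] -/
theorem cut_edge_facts :
    (Pi.single k (s * (j₀ - 1)) + Pi.single k.rev (t * N j₀) : Site 2) ∈
        (⟨D.carrier, δ, ∅, ∅⟩ : DiscreteDobrushin).zdBoundary ∧
      (Pi.single k (s * j₀) + Pi.single k.rev (t * N j₀) : Site 2) ∈
        (⟨D.carrier, δ, ∅, ∅⟩ : DiscreteDobrushin).zdBoundary ∧
      (discreteDomainGraph D.carrier δ).Adj (Pi.single k (s * (j₀ - 1)) + Pi.single k.rev (t * N j₀))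
        (Pi.single k (s * j₀) + Pi.single k.rev (t * N j₀)) ∧
      dist (meshPoint δ (Pi.single k (s * (j₀ - 1)) + Pi.single k.rev (t * N j₀))) (D.pt i) ≤ 5 * δ ∧
      dist (meshPoint δ (Pi.single k (s * j₀) + Pi.single k.rev (t * N j₀))) (D.pt i) ≤ 5 * δ ∧
      s * (Pi.single k (s * (j₀ - 1)) + Pi.single k.rev (t * N j₀) : Site 2) k = j₀ - 1 ∧
      s * (Pi.single k (s * j₀) + Pi.single k.rev (t * N j₀) : Site 2) k = j₀ ∧
      ∃! f, (⟨D.carrier, δ, ∅, ∅⟩ : DiscreteDobrushin).IsInnerFace f ∧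
        ∀ x ∈ s(Pi.single k (s * (j₀ - 1)) + Pi.single k.rev (t * N j₀),
          (Pi.single k (s * j₀) + Pi.single k.rev (t * N j₀) : Site 2)), LatticeModels.IsCorner x f := by
  set E : DiscreteDobrushin := ⟨D.carrier, δ, ∅, ∅⟩ with hE
  have hδ' : 0 < E.δ := hδ
  have hδR' : 32 * E.δ ≤ R := by change 32 * δ ≤ R; linarith
  have hjδ : |E.δ * j₀ - α| ≤ E.δ := abs_cut_col_le hδ j₀ hj₀
  obtain ⟨hfb, huniq⟩ := cut_faces (E := E) hs ht hU hV hp hδ' hδR' hmono hlip hepi hbulk hN j₀ hjδ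
  have c0 := col_frameSite k hs ht (j₀ - 1) (N j₀)
  have r0 := row_frameSite k hs ht (j₀ - 1) (N j₀)
  have c1 := col_frameSite k hs ht j₀ (N j₀)
  have r1 := row_frameSite k hs ht j₀ (N j₀)
  refine ⟨hfb.mem_zdBoundary.1, hfb.mem_zdBoundary.2, hfb.1, ?_, ?_, c0, c1, huniq⟩
  · exact dist_le_of_near_cut (E := E) hs ht hU hV hp hδ' hlip hN j₀ hjδ (by rw [c0]; simp) (by rw [r0]; simp)
  · exact dist_le_of_near_cut (E := E) hs ht hU hV hp hδ' hlip hN j₀ hjδ (by rw [c1]; simp) (by rw [r1]; simp)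

include hs ht hU hV hp hmono hepi hδ hδR hN hbulk in
/-- **Uniqueness of the cut edge.** An edge of `Ω_δ` between boundary sites near the mark with
different column tests is the cut edge. [folklore] -/
theorem eq_cut_of_crossing {x y : Site 2} (hxy : (discreteDomainGraph D.carrier δ).Adj x y)
    (hx : x ∈ (⟨D.carrier, δ, ∅, ∅⟩ : DiscreteDobrushin).zdBoundary)
    (hy : y ∈ (⟨D.carrier, δ, ∅, ∅⟩ : DiscreteDobrushin).zdBoundary)
    (hxp : dist (meshPoint δ x) (D.pt i) < R / 4 - 4 * δ)
    (hne : ¬ ((j₀ ≤ s * x k ↔ σ = 0) ↔ (j₀ ≤ s * y k ↔ σ = 0))) :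
    s(x, y) = s(Pi.single k (s * (j₀ - 1)) + Pi.single k.rev (t * N j₀),
      (Pi.single k (s * j₀) + Pi.single k.rev (t * N j₀) : Site 2)) := by
  set E : DiscreteDobrushin := ⟨D.carrier, δ, ∅, ∅⟩ with hE
  have hδ' : 0 < E.δ := hδ
  have hδR' : 32 * E.δ ≤ R := by change 32 * δ ≤ R; linarith
  have hzd := (meshGraph_adj_iff.1 (discreteDomainGraph_adj_iff.1 hxy).1).1
  have hyp : dist (meshPoint δ y) (D.pt i) < R / 4 - 2 * δ := by
    have h1 : dist (meshPoint δ y) (meshPoint δ x) ≤ 2 * δ := by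
      rw [dist_meshPoint_of_adj hzd.symm, abs_of_pos hδ]; linarith
    have := dist_triangle (meshPoint δ y) (meshPoint δ x) (D.pt i)
    linarith
  have hxp' : dist (meshPoint δ x) (D.pt i) < R / 4 - 2 * δ := by linarith
  have hcases : (s * x k < j₀ ∧ j₀ ≤ s * y k) ∨ (s * y k < j₀ ∧ j₀ ≤ s * x k) := by
    by_cases h : j₀ ≤ s * x k <;> by_cases h' : j₀ ≤ s * y k
    · exact (hne (by simp [h, h'])).elim
    · exact Or.inr ⟨not_le.1 h', h⟩
    · exact Or.inl ⟨not_le.1 h, h'⟩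
    · exact (hne (by simp [h, h'])).elim
  rcases hcases with ⟨h1, h2⟩ | ⟨h1, h2⟩
  · obtain ⟨rfl, rfl⟩ := eq_cut_of_adj (E := E) hs ht hU hV hp hδ' hδR' hmono hepi hbulk hN j₀ hxy hx hxp' h1 h2
    rfl
  · obtain ⟨rfl, rfl⟩ := eq_cut_of_adj (E := E) hs ht hU hV hp hδ' hδR' hmono hepi hbulk hN j₀ hxy.symm hy hyp h1 h2
    exact Sym2.eq_swap

include hs ht hU hV hp hmono hlip hepi hdiff hσp hσm hfar hδ hδR hbulk in
/-- **Per-mark package for the assembly.** With `N j = ⌊G (δ j) / δ⌋ + 1`, `j₀ = ⌊α / δ⌋ + 1`, the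
column test `C x = (j₀ ≤ col x ↔ σ = 0)` and the cut edge `{(j₀ - 1, N j₀), (j₀, N j₀)}`: a label `P`
which is the column test within `6δ` of the mark and the Voronoi comparison beyond agrees with the
column test near the mark; shared nearest frontier points force equal tests; the cut edge joins two
boundary sites with opposite tests within `5δ` of the mark, is the only such edge nearby, and
bounds exactly one inner face. [folklore] -/
theorem perMark_facts (P : Site 2 → Prop)
    (hnear : ∀ x, dist (meshPoint δ x) (D.pt i) < 6 * δ → (P x ↔ (⌊α / δ⌋ + 1 ≤ s * x k ↔ σ = 0)))
    (hvor : ∀ x, 6 * δ ≤ dist (meshPoint δ x) (D.pt i) → 6 * δ ≤ dist (meshPoint δ x) (D.pt (i + 1)) →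
      (P x ↔ infDist (meshPoint δ x) (D.arc 0) ≤ infDist (meshPoint δ x) (D.arc 1))) :
    (∀ x ∈ (⟨D.carrier, δ, ∅, ∅⟩ : DiscreteDobrushin).zdBoundary,
      dist (meshPoint δ x) (D.pt i) < R / 4 - 2 * δ → (P x ↔ (⌊α / δ⌋ + 1 ≤ s * x k ↔ σ = 0))) ∧
    (∀ x ∈ (⟨D.carrier, δ, ∅, ∅⟩ : DiscreteDobrushin).zdBoundary,
      ∀ y ∈ (⟨D.carrier, δ, ∅, ∅⟩ : DiscreteDobrushin).zdBoundary,
      dist (meshPoint δ x) (D.pt i) < R / 4 - 2 * δ → dist (meshPoint δ y) (D.pt i) < R / 4 - 2 * δ →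
      ∀ q ∈ frontier D.carrier, dist (meshPoint δ x) q = infDist (meshPoint δ x) (frontier D.carrier) →
      dist (meshPoint δ y) q = infDist (meshPoint δ y) (frontier D.carrier) →
      ((⌊α / δ⌋ + 1 ≤ s * x k ↔ σ = 0) ↔ (⌊α / δ⌋ + 1 ≤ s * y k ↔ σ = 0))) ∧
    ((Pi.single k (s * (⌊α / δ⌋ + 1 - 1)) +
        Pi.single k.rev (t * (⌊G (δ * (⌊α / δ⌋ + 1 : ℤ)) / δ⌋ + 1)) : Site 2) ∈
        (⟨D.carrier, δ, ∅, ∅⟩ : DiscreteDobrushin).zdBoundary ∧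
      (Pi.single k (s * (⌊α / δ⌋ + 1)) +
        Pi.single k.rev (t * (⌊G (δ * (⌊α / δ⌋ + 1 : ℤ)) / δ⌋ + 1)) : Site 2) ∈
        (⟨D.carrier, δ, ∅, ∅⟩ : DiscreteDobrushin).zdBoundary ∧
      (discreteDomainGraph D.carrier δ).Adj
        (Pi.single k (s * (⌊α / δ⌋ + 1 - 1)) + Pi.single k.rev (t * (⌊G (δ * (⌊α / δ⌋ + 1 : ℤ)) / δ⌋ + 1)))
        (Pi.single k (s * (⌊α / δ⌋ + 1)) + Pi.single k.rev (t * (⌊G (δ * (⌊α / δ⌋ + 1 : ℤ)) / δ⌋ + 1))) ∧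
      dist (meshPoint δ (Pi.single k (s * (⌊α / δ⌋ + 1 - 1)) +
        Pi.single k.rev (t * (⌊G (δ * (⌊α / δ⌋ + 1 : ℤ)) / δ⌋ + 1)))) (D.pt i) ≤ 5 * δ ∧
      dist (meshPoint δ (Pi.single k (s * (⌊α / δ⌋ + 1)) +
        Pi.single k.rev (t * (⌊G (δ * (⌊α / δ⌋ + 1 : ℤ)) / δ⌋ + 1)))) (D.pt i) ≤ 5 * δ ∧
      ¬ ((⌊α / δ⌋ + 1 ≤ s * (Pi.single k (s * (⌊α / δ⌋ + 1 - 1)) +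
          Pi.single k.rev (t * (⌊G (δ * (⌊α / δ⌋ + 1 : ℤ)) / δ⌋ + 1)) : Site 2) k ↔ σ = 0) ↔
        (⌊α / δ⌋ + 1 ≤ s * (Pi.single k (s * (⌊α / δ⌋ + 1)) +
          Pi.single k.rev (t * (⌊G (δ * (⌊α / δ⌋ + 1 : ℤ)) / δ⌋ + 1)) : Site 2) k ↔ σ = 0))) ∧
    (∀ x y, (discreteDomainGraph D.carrier δ).Adj x y →
      x ∈ (⟨D.carrier, δ, ∅, ∅⟩ : DiscreteDobrushin).zdBoundary →
      y ∈ (⟨D.carrier, δ, ∅, ∅⟩ : DiscreteDobrushin).zdBoundary →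
      dist (meshPoint δ x) (D.pt i) < R / 4 - 4 * δ →
      ¬ ((⌊α / δ⌋ + 1 ≤ s * x k ↔ σ = 0) ↔ (⌊α / δ⌋ + 1 ≤ s * y k ↔ σ = 0)) →
      s(x, y) = s(Pi.single k (s * (⌊α / δ⌋ + 1 - 1)) +
          Pi.single k.rev (t * (⌊G (δ * (⌊α / δ⌋ + 1 : ℤ)) / δ⌋ + 1)),
        (Pi.single k (s * (⌊α / δ⌋ + 1)) +
          Pi.single k.rev (t * (⌊G (δ * (⌊α / δ⌋ + 1 : ℤ)) / δ⌋ + 1)) : Site 2))) ∧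
    ∃! f, (⟨D.carrier, δ, ∅, ∅⟩ : DiscreteDobrushin).IsInnerFace f ∧
      ∀ x ∈ s(Pi.single k (s * (⌊α / δ⌋ + 1 - 1)) +
          Pi.single k.rev (t * (⌊G (δ * (⌊α / δ⌋ + 1 : ℤ)) / δ⌋ + 1)),
        (Pi.single k (s * (⌊α / δ⌋ + 1)) +
          Pi.single k.rev (t * (⌊G (δ * (⌊α / δ⌋ + 1 : ℤ)) / δ⌋ + 1)) : Site 2)),
        LatticeModels.IsCorner x f := by
  set N : ℤ → ℤ := fun j => ⌊G (δ * j) / δ⌋ + 1 with hNd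
  have hN : ∀ j : ℤ, N j = ⌊G (δ * j) / δ⌋ + 1 := fun j => rfl
  set j₀ : ℤ := ⌊α / δ⌋ + 1 with hj₀
  obtain ⟨h0, h1, hadj, hd0, hd1, hc0, hc1, huniq⟩ :=
    cut_edge_facts D i hs ht hU hV hp hmono hlip hepi hδ hδR hN hbulk j₀ hj₀
  refine ⟨fun x hx hxp => label_iff_column D i hs ht hU hV hp hmono hlip hepi hσp hσm hfar hδ hδR hN hbulk P
      hnear hvor hx hxp,
    fun x hx y hy hxp hyp q hq hqx hqy => column_iff_of_shared_nearest D i hs ht hU hV hp hmono hlip hepi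
      hdiff hδ hδR hN hbulk hx hy hxp hyp hq hqx hqy,
    ⟨h0, h1, hadj, hd0, hd1, ?_⟩,
    fun x y hxy hx hy hxp hne => eq_cut_of_crossing D i hs ht hU hV hp hmono hepi hδ hδR hN hbulk j₀
      hxy hx hy hxp hne, huniq⟩
  rw [hc0, hc1]
  have h1' : ¬ (j₀ ≤ j₀ - 1) := by omega
  simp only [h1', le_refl, false_iff, true_iff]
  tauto

end PerMark

end SmoothMark

/-! ### Registered sub-goal (one-line signature, verbatim) -/

/-- **Registered sub-goal `smoothMark_part8` of `stub_smoothMarkFamilies`**: the bulk input of the local analysis holds at all small meshes (Jordan bulk lemma). [folklore] -/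
theorem smoothMark_part8 : ∀ (D : DobrushinDomain) (i : Fin 2) (k : Fin 2) (s t : ℤ) (U V : ℂ) (G : ℝ → ℝ) (α R : ℝ), (s = 1 ∨ s = -1) → (t = 1 ∨ t = -1) → U = Site.toComplex (Pi.single k s) → V = Site.toComplex (Pi.single k.rev t) → D.pt i = (α : ℂ) * U + ((G α : ℝ) : ℂ) * V → (∀ a b, |G a - G b| ≤ |a - b|) → (∀ a b : ℝ, dist ((a : ℂ) * U + (b : ℂ) * V) (D.pt i) < R → ((a : ℂ) * U + (b : ℂ) * V ∈ D.carrier ↔ G a < b)) → 0 < R → ∃ δ₀ > 0, ∀ δ : ℝ, 0 < δ → δ < δ₀ → ∀ x : Site 2, |δ * (s * x k) - α| ≤ R / 4 → 3 * R / 8 ≤ δ * (t * x k.rev) - G α → δ * (t * x k.rev) - G α ≤ R / 2 → x ∈ meshDomain D.carrier δ :=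
  fun D i _ _ _ _ _ _ _ _ hs ht hU hV hp hlip hepi hR => SmoothMark.eventually_bulk D i hs ht hU hV hp hlip hepi hR

end Summit.CriticalPhenomena.CardyFormulaZ2.Cruxes.SLESixFamiliesGiveCardy.CollarTouchSandwich

end
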